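import Summits.QuantumFields.YangMills.Theorems.F4SubCurvatureDoorSmearedSlices
import Literature.Analysis.Fourier.HeckeIdentity
import Mathlib
import HarnessLib

/-!
# Route `F4SubCurvatureDoor`, crux ⟨stmt-QuantumFields-23125⟩ `RationalToGeneral`: LINE g18-A v5 — CSF build plan C3a:
# HARMONIC–GAUSSIAN SMEARED SLICES of a Laplace–Fourier measure have EXPLICIT momentum weights (Hecke)

For an abstract Laplace–Fourier pair `(k, μ)` on `ℝ³` (`k(z⃗) = ∫ e^{−tE} cos⟪q⃗, z⃗⟫ dμ(E, q⃗)`, `e^{−tE}` `μ`-integrable; instantiate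
`k := K (timeSpace t ·)` for a class kernel `K` and its S1 measure ✓p696429/p697330) and a real harmonic homogeneous polynomial `Y` of
degree `j` on `ℝ³`, `a > 0`:

  ★ `integral_harmonicGaussian_smeared_eq`:
    `∫_{ℝ³} k(z⃗) Y(z⃗) e^{−a‖z⃗‖²} dz⃗ = (π/a)^{3/2} Re((−i/(2a))^j) ∫ e^{−tE} Y(q⃗) e^{−‖q⃗‖²/(4a)} dμ(E, q⃗)`,

i.e. smearing a slice with a harmonic Gaussian in position space tests the Laplace–Fourier measure against the SAME harmonic times the
dual Gaussian in momentum space (✓`F4SubCurvatureDoorSmearedSlices.integral_smeared_eq` + the cosine form of Hecke's identity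
✓`Literature.Analysis.Fourier.integral_eval_mul_exp_mul_cos`).  These are the explicit «smeared Stieltjes slices» of the owner's build plan
§4(a)/(c) (`Lines/sextic_channel_stubplans.md`), with angular resolution in `q⃗` given by spherical harmonics — the entry point for reading
the `SO(3)`-channel structure of `μ_t` off position-space data; `j = 0` recovers the plain Gaussian slice.
Also: `integrable_eval_mul_exp` (polynomial × Gaussian is integrable on `ℝ³`, public here for downstream use).

THEOREMS ONLY; Mathlib + tree; no `sorry`; standard axioms.  HONEST LABEL: measure-theory/Fourier bookkeeping for an OPEN XL stub; nothing
here bears on C3, T1″, ⟨23125⟩ / ⟨23035⟩, rung R2d or the summit; the Yang–Mills mass gap is NOT proved; no summit is proved by a line.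
Seat `ym-line-frs-p2` g14 (free hands), `--supports stmt-QuantumFields-23125`. [cite: SteinWeiss1971, Ch. IV Thm. 3.4]
-/

set_option autoImplicit false

noncomputable section

namespace Summit.QuantumFields.YangMills.Theorems.F4SubCurvatureDoorHarmonicGaussianSlices

open MvPolynomial MeasureTheory
open scoped BigOperators RealInnerProductSpace
open Summit.QuantumFields.YangMills.Theorems.F4SubCurvatureDoorSmearedSlices (integral_smeared_eq)
open Literature.Analysis.Fourier (integral_eval_mul_exp_mul_cos)

/-! ## § 1. Polynomial × Gaussian integrability on `ℝᵐ` (public copy for downstream use) -/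

/-- The Gaussian `e^{−a‖x‖²}` is integrable on `ℝᵐ` (`a > 0`). [folklore] -/
theorem integrable_exp_neg_mul_sq_norm {m : ℕ} {a : ℝ} (ha : 0 < a) :
    Integrable (fun x : EuclideanSpace ℝ (Fin m) => Real.exp (-(a * ‖x‖ ^ 2))) := by
  refine Integrable.of_integral_ne_zero (fun h => ?_)
  have h1 := GaussianFourier.integral_rexp_neg_mul_sq_norm (V := EuclideanSpace ℝ (Fin m)) ha
  have h2 : (fun v : EuclideanSpace ℝ (Fin m) => Real.exp (-a * ‖v‖ ^ 2)) = fun v => Real.exp (-(a * ‖v‖ ^ 2)) := by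
    funext v; ring_nf
  rw [h2, h] at h1
  have : (0 : ℝ) < (Real.pi / a) ^ (Module.finrank ℝ (EuclideanSpace ℝ (Fin m)) / 2 : ℝ) := by positivity
  linarith

/-- **Polynomial functions times Gaussians are integrable on `ℝᵐ`** (induction on the polynomial: `xᵢ e^{−a‖x‖²/2}` is bounded).
[folklore] -/
theorem integrable_eval_mul_exp {m : ℕ} (P : MvPolynomial (Fin m) ℝ) {a : ℝ} (ha : 0 < a) :
    Integrable (fun x : EuclideanSpace ℝ (Fin m) => eval (WithLp.ofLp x) P * Real.exp (-(a * ‖x‖ ^ 2))) := by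
  induction P using MvPolynomial.induction_on generalizing a with
  | C c =>
    simpa using (integrable_exp_neg_mul_sq_norm ha).const_mul c
  | add p q hp hq =>
    refine ((hp ha).add (hq ha)).congr (Filter.Eventually.of_forall fun x => ?_)
    simp only [Pi.add_apply, map_add, add_mul]
  | mul_X p i hp =>
    have ha2 : 0 < a / 2 := by positivity
    have hmeas : AEStronglyMeasurable (fun x : EuclideanSpace ℝ (Fin m) => x i * Real.exp (-(a / 2 * ‖x‖ ^ 2))) volume := by
      have : Continuous fun x : EuclideanSpace ℝ (Fin m) => x i * Real.exp (-(a / 2 * ‖x‖ ^ 2)) := by fun_prop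
      exact this.aestronglyMeasurable
    have hbd : ∀ x : EuclideanSpace ℝ (Fin m), |x i| * Real.exp (-(a / 2 * ‖x‖ ^ 2)) ≤ (1 + 1 / (a / 2)) / 2 := by
      intro x
      have hxi : |x i| ≤ ‖x‖ := by
        have := PiLp.norm_apply_le x i
        rwa [Real.norm_eq_abs] at this
      have hexp1 : Real.exp (-(a / 2 * ‖x‖ ^ 2)) ≤ 1 := by
        rw [Real.exp_le_one_iff]; nlinarith [norm_nonneg x]
      have hexp2 : a / 2 * ‖x‖ ^ 2 * Real.exp (-(a / 2 * ‖x‖ ^ 2)) ≤ 1 := by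
        have h := Real.add_one_le_exp (a / 2 * ‖x‖ ^ 2)
        have hpos : 0 < Real.exp (a / 2 * ‖x‖ ^ 2) := Real.exp_pos _
        rw [Real.exp_neg, mul_inv_le_iff₀ hpos]
        nlinarith [norm_nonneg x]
      have hamgm : ‖x‖ ≤ (1 + ‖x‖ ^ 2) / 2 := by nlinarith [sq_nonneg (‖x‖ - 1)]
      have he0 : 0 ≤ Real.exp (-(a / 2 * ‖x‖ ^ 2)) := (Real.exp_pos _).le
      calc |x i| * Real.exp (-(a / 2 * ‖x‖ ^ 2))
          ≤ (1 + ‖x‖ ^ 2) / 2 * Real.exp (-(a / 2 * ‖x‖ ^ 2)) := mul_le_mul_of_nonneg_right (hxi.trans hamgm) he0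
        _ = (Real.exp (-(a / 2 * ‖x‖ ^ 2)) + (1 / (a / 2)) * (a / 2 * ‖x‖ ^ 2 * Real.exp (-(a / 2 * ‖x‖ ^ 2)))) / 2 := by
            field_simp
        _ ≤ (1 + (1 / (a / 2)) * 1) / 2 := by gcongr
        _ = (1 + 1 / (a / 2)) / 2 := by ring
    have h := (hp ha2).mul_bdd hmeas (c := (1 + 1 / (a / 2)) / 2)
      (Filter.Eventually.of_forall fun x => by
        rw [Real.norm_eq_abs, abs_mul, abs_of_pos (Real.exp_pos _)]
        exact hbd x)
    refine h.congr (Filter.Eventually.of_forall fun x => ?_)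
    simp only [map_mul, eval_X]
    have : Real.exp (-(a * ‖x‖ ^ 2)) = Real.exp (-(a / 2 * ‖x‖ ^ 2)) * Real.exp (-(a / 2 * ‖x‖ ^ 2)) := by
      rw [← Real.exp_add]; ring_nf
    rw [this]; ring

/-! ## § 2. Harmonic–Gaussian smeared slices -/

/-- ★ **Harmonic–Gaussian smeared slice of a Laplace–Fourier measure.**  For an LF pair `(k, μ)` on `ℝ³` (`e^{−tE}` `μ`-integrable,
`k(z⃗) = ∫ e^{−tE} cos⟪q⃗, z⃗⟫ dμ`) and `Y` harmonic homogeneous of degree `j` on `ℝ³`, `a > 0`: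
`∫ k(z⃗) Y(z⃗) e^{−a‖z⃗‖²} dz⃗ = (π/a)^{3/2} Re((−i/(2a))^j) ∫ e^{−tE} Y(q⃗) e^{−‖q⃗‖²/(4a)} dμ(E, q⃗)`.
[cite: SteinWeiss1971, Ch. IV Thm. 3.4] -/
theorem integral_harmonicGaussian_smeared_eq (μ : Measure (ℝ × EuclideanSpace ℝ (Fin 3))) (t : ℝ)
    (hint : Integrable (fun p : ℝ × EuclideanSpace ℝ (Fin 3) => Real.exp (-(t * p.1))) μ)
    (k : EuclideanSpace ℝ (Fin 3) → ℝ)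
    (hk : ∀ z, k z = ∫ p, Real.exp (-(t * p.1)) * Real.cos (inner ℝ p.2 z) ∂μ)
    (Y : MvPolynomial (Fin 3) ℝ) {j : ℕ} (hYj : Y.IsHomogeneous j) (hY : ∑ i, pderiv i (pderiv i Y) = 0)
    {a : ℝ} (ha : 0 < a) :
    ∫ z : EuclideanSpace ℝ (Fin 3), k z * (eval (WithLp.ofLp z) Y * Real.exp (-(a * ‖z‖ ^ 2)))
      = (Real.pi / a) ^ (3 / 2 : ℝ) * ((-Complex.I / (2 * (a : ℂ))) ^ j).re *
          ∫ p, Real.exp (-(t * p.1)) * (eval (WithLp.ofLp p.2) Y * Real.exp (-(‖p.2‖ ^ 2 / (4 * a)))) ∂μ := by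
  -- Fubini: the smeared slice is `∫ e^{−tE} Φ(q) dμ` with `Φ(q) = ∫ cos⟪q,z⟫ Y(z) e^{−a‖z‖²} dz`
  rw [integral_smeared_eq μ t hint k hk _ (integrable_eval_mul_exp Y ha)]
  -- Hecke (cosine form) evaluates `Φ`
  have hΦ : ∀ q : EuclideanSpace ℝ (Fin 3),
      ∫ z : EuclideanSpace ℝ (Fin 3), Real.cos (inner ℝ q z) * (eval (WithLp.ofLp z) Y * Real.exp (-(a * ‖z‖ ^ 2)))
        = (Real.pi / a) ^ (3 / 2 : ℝ) * ((-Complex.I / (2 * (a : ℂ))) ^ j).re * eval (WithLp.ofLp q) Y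
            * Real.exp (-(‖q‖ ^ 2 / (4 * a))) := by
    intro q
    have h := integral_eval_mul_exp_mul_cos Y hYj hY ha q
    simp only [Nat.cast_ofNat] at h
    rw [← h]
    refine integral_congr_ae (Filter.Eventually.of_forall fun z => ?_)
    ring
  simp_rw [hΦ]
  rw [← integral_const_mul]
  refine integral_congr_ae (Filter.Eventually.of_forall fun p => ?_)
  ring

end Summit.QuantumFields.YangMills.Theorems.F4SubCurvatureDoorHarmonicGaussianSlices

end
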